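import Mathlib.Algebra.Homology.Linear
import Mathlib.Algebra.Homology.ShortComplex.Linear
import Literature.NumberTheory.Automorphic.HidaIndependenceOfWeightTensor
import Literature.NumberTheory.Automorphic.SymCoeffLatticeTensorBridge
import Literature.NumberTheory.Automorphic.HidaLevelDiamondAction
import Literature.NumberTheory.Automorphic.LevelActionHeckeMultiplicative
import Literature.NumberTheory.Automorphic.ModPHeckeEigensystemGL
import HarnessLib

/-!
# The weight bridge: lattice cohomology of weight `k` versus trivial coefficients, at finite level

Topic `NumberTheory/Automorphic`; namespaces `Literature.NumberTheory.Automorphic` (one generic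
linearity lemma), `Literature.NumberTheory.Automorphic.IntegralWeightGL2` (values of the product
character) and `Literature.NumberTheory.Automorphic.BigHeckeGLn.TameLevel`; definitions with bodies
(the comparison map `weightBridge`) and theorems; no named fact, no `sorry`.

Independence of weight ([KhareThorne2017, §6.4, Prop. 6.13]; [Hida1994AIF, §2, Prop. 2.1]) in the
form used by the levelwise support argument of Hida's control theorem: for torsion coefficients `S`
(e.g. `S = O/p^n`), reductions `red_τ : 𝒪_{F,v(τ)} → S` killing the ball of radius `|ϖ|^b`
(`b ≤ c`), the tree's independence-of-weight bijection (`HidaIndependenceOfWeightTensor`) and the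
lattice/tensor identification (`SymCoeffLatticeTensorBridge`) assemble to an `S`-linear map

  `weightBridge : H^i(U(b,c), ⨂_τ Sym^{k−2}(S²)) → H^i(X_{U(b,c)}, S)`

(lattice model: integral monoid, `symLatticeAction`; target: the arithmetic-quotient cohomology with
trivial coefficients), with

* `weightBridge_comp_heckeCohomology` — **twisted Hecke equivariance**
  `Φ ∘ [U g U] = (∏χ)(g) · T_g ∘ Φ` for `g` in the multi-place Iwahori monoid, `(∏χ)(g) =
  ∏_τ red_τ((g_{v(τ)})₁₁)^{k−2}`; on the nose for the good `t_{w,j}` and the `U_{v,1}`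
  (`lowCharFunJ_eq_one_of_forall`, `lowCharFunJ_heckeElement`), and with the factor
  `∏_τ red_τ(u_{v(τ),1})^{k−2}` for the diamonds `diamondPi u` (`lowCharFunJ_diamondPi`);
* `bijOn_weightBridge` — **`Φ` is a bijection from the `U_p`-ordinary part `⋂_{v∣p} ⋂ₘ range U_{v,1}^m`
  of the lattice side onto that of `H^i(X_{U(b,c)}, S)`** (finite cohomology groups, `1 ≤ r ≤ c`,
  `red_τ(ϖ)^r = 0`), the ordinary parts for `U_p^{(r)} = ∏_v t_v^r` being converted to the
  intersections over the places above `p` (`iInf_range_pow_upElement_eq`).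

## References

* C. Khare, J. A. Thorne, *Potential automorphy and the Leopoldt conjecture*, Amer. J. Math. 139
  (2017), §6.4, Prop. 6.13 (arXiv:1409.7007, held). [KhareThorne2017]
* H. Hida, *p-adic ordinary Hecke algebras for GL(2)*, Ann. Inst. Fourier 44 (1994), §2 Prop. 2.1, §3
  (held). [Hida1994AIF]
-/

noncomputable section

open CategoryTheory IsDedekindDomain
open scoped NumberField

universe u

namespace Literature.NumberTheory.Automorphic

namespace ArithmeticQuotient

variable {k : Type u} [CommRing k] {Γ 𝒢 : Type u} [Group Γ] [Group 𝒢] (ι : Γ →* 𝒢) (L : Subgroup 𝒢)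
  {M : Type u} [AddCommGroup M] [Module k M]

/-- **The change of coefficients along a scalar is the scalar**: `H^i(c · id) = c · id` on
`H^i(X_L, M)`. [folklore] -/
theorem cohomologyCoeffMap_hom_apply_of_forall_eq_smul (φ : M →ₗ[k] M) (c : k) (hφ : ∀ m, φ m = c • m) (i : ℕ)
    (x : cohomology k ι L M i) : (cohomologyCoeffMap ι L φ i).hom x = c • x := by
  have hco : coeffHom ι L φ = c • 𝟙 (coeffRep k ι L M) :=
    Rep.hom_ext (Representation.IntertwiningMap.ext (LinearMap.ext fun f => funext fun y => by
      change φ (f y) = c • f y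
      exact hφ (f y)))
  dsimp only [cohomologyCoeffMap]
  rw [hco, groupCohomology_map_id_smul, groupCohomology.map_id]
  rfl

end ArithmeticQuotient

/-! ### Values of the product character `∏χ` -/

namespace IntegralWeightGL2

open BigHeckeGLn

variable {K : Type} [Field K] [NumberField K] {S : Type} [CommRing S] {J : Type} [Fintype J]
  {v : J → HeightOneSpectrum (𝓞 K)} (red : ∀ j : J, (v j).adicCompletionIntegers K →+* S) (m : J → ℕ)

/-- **`(∏χ)(g) = 1` when every component `g_{v j}` is trivial** (e.g. the good `t_{w,j}`). [folklore] -/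
theorem lowCharFunJ_eq_one_of_forall (g : multiIwahoriMonoid K v red)
    (h : ∀ j, localComponent 2 K (v j) (g : FiniteAdelicGL 2 K) = 1) : lowCharFunJ K v red m g = 1 := by
  rw [lowCharFunJ_apply]
  refine Finset.prod_eq_one fun j _ => ?_
  have h1 : redMatrix K (v j) (red j) (inclAt K v red j g) 1 1 = redMatrix K (v j) (red j) 1 1 1 :=
    redMatrix_eq_of_localComponent_eq (by rw [coe_inclAt, h j, OneMemClass.coe_one, map_one]) 1 1
  rw [h1, map_one, Matrix.one_apply_eq, one_pow]

/-- **`(∏χ)(t_{w,1}) = 1`** for a place `w` (above `p` or not): `red((t_w)₁₁)^{m} = red(1)^m = 1`.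
[folklore] -/
theorem lowCharFunJ_heckeElement (w : HeightOneSpectrum (𝓞 K)) (hw : heckeElement 2 K w 1 ∈ multiIwahoriMonoid K v red) :
    lowCharFunJ K v red m ⟨heckeElement 2 K w 1, hw⟩ = 1 := by
  rw [lowCharFunJ_apply]
  refine Finset.prod_eq_one fun j _ => ?_
  by_cases hj : v j = w
  · have h := redMatrix_pow_eq_one_of_lowChar_eq_one (lowChar_heckeElement_pow (red j) (m j) 1)
    have h2 : redMatrix K (v j) (red j) (inclAt K v red j ⟨heckeElement 2 K w 1, hw⟩) 1 1 =
        redMatrix K (v j) (red j) ⟨heckeElement 2 K (v j) 1 ^ 1, heckeElement_pow_mem_iwahoriMonoid K (v j) (red j) 1⟩ 1 1 :=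
      redMatrix_eq_of_localComponent_eq (by
        change localComponent 2 K (v j) (heckeElement 2 K w 1) = localComponent 2 K (v j) (heckeElement 2 K (v j) 1 ^ 1)
        rw [pow_one, hj]) 1 1
    rw [h2]
    exact h
  · have h1 : redMatrix K (v j) (red j) (inclAt K v red j ⟨heckeElement 2 K w 1, hw⟩) 1 1 =
        redMatrix K (v j) (red j) 1 1 1 :=
      redMatrix_eq_of_localComponent_eq (by
        change localComponent 2 K (v j) (heckeElement 2 K w 1) = localComponent 2 K (v j) 1
        rw [heckeElement_eq_ofLocal, localComponent_ofLocal_of_ne hj, map_one]) 1 1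
    rw [h1, map_one, Matrix.one_apply_eq, one_pow]

omit [Fintype J] in
/-- `t_{w,1}` lies in the multi-place Iwahori monoid (any place `w`). [folklore] -/
theorem heckeElementOne_mem_multiIwahoriMonoid (w : HeightOneSpectrum (𝓞 K)) :
    heckeElement 2 K w 1 ∈ multiIwahoriMonoid K v red :=
  mem_multiIwahoriMonoid_iff.2 fun j => by
    by_cases hj : v j = w
    · exact mem_iwahoriMonoid_of_localComponent_eq (g' := heckeElement 2 K (v j) 1 ^ 1) (by rw [pow_one, hj])
        (heckeElement_pow_mem_iwahoriMonoid K (v j) (red j) 1)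
    · exact mem_iwahoriMonoid_of_localComponent_eq (g' := 1)
        (by rw [heckeElement_eq_ofLocal, localComponent_ofLocal_of_ne hj, map_one]) (Submonoid.one_mem _)

variable {p : ℕ} [Fact p.Prime]

/-- **`(∏χ)(diamondPi u) = ∏_j red_j(u_{v j, 1})^{m_j}`** — the slot-`1` diamond twist at all the index
places (`v j` above `p`). [cite: KhareThorne2017, §6.4] -/
theorem lowCharFunJ_diamondPi (hv : ∀ j, (p : 𝓞 K) ∈ (v j).asIdeal)
    (u : ∀ w : PlacesAbove K p, (Fin 2 → (w.1.adicCompletionIntegers K)ˣ))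
    (hu : diamondPi 2 K p u ∈ multiIwahoriMonoid K v red) :
    lowCharFunJ K v red m ⟨diamondPi 2 K p u, hu⟩ =
      ∏ j, red j ((u ⟨v j, hv j⟩ 1 : ((v j).adicCompletionIntegers K)ˣ) : (v j).adicCompletionIntegers K) ^ (m j) := by
  rw [lowCharFunJ_apply]
  refine Finset.prod_congr rfl fun j _ => ?_
  have h2 : redMatrix K (v j) (red j) (inclAt K v red j ⟨diamondPi 2 K p u, hu⟩) 1 1 =
      redMatrix K (v j) (red j) ⟨diamondElement 2 K (v j) (u ⟨v j, hv j⟩), diamondElement_mem_iwahoriMonoid (red j) _⟩ 1 1 :=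
    redMatrix_eq_of_localComponent_eq (by
      change localComponent 2 K (v j) (diamondPi 2 K p u) = localComponent 2 K (v j) (diamondElement 2 K (v j) (u ⟨v j, hv j⟩))
      rw [localComponent_diamondPi u ⟨v j, hv j⟩, diamondElement_apply, localComponent_ofLocal]) 1 1
  have h3 := lowChar_diamondElement_apply (red j) (m j) (u ⟨v j, hv j⟩) 1
  rw [lowChar_apply, mul_one, mul_one] at h3
  rw [h2, h3]

end IntegralWeightGL2

/-! ### The weight bridge -/

namespace BigHeckeGLn

namespace TameLevel

open LevelAction IntegralWeightGL2 ParallelWeight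

variable {F : Type} [Field F] [NumberField F] {p : ℕ} [Fact p.Prime] (𝒰 : TameLevel 2 F p)
  {S : Type} [CommRing S] {E : Type} [Field E] [CharZero E] (k : ℕ)
  {v : (F →+* E) → HeightOneSpectrum (𝓞 F)} {b c : ℕ}

omit [CharZero E] in
/-- The level `U(b,c)` lies in the integral monoid. [folklore] -/
theorem level_le_integralMonoid' (hv : ∀ τ, (p : 𝓞 F) ∈ (v τ).asIdeal)
    (red : ∀ τ : F →+* E, (v τ).adicCompletionIntegers F →+* S) (hbc : b ≤ c)
    (hred : ∀ τ (x : (v τ).adicCompletionIntegers F),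
      Valued.v (x : (v τ).adicCompletion F) ≤ (WithZero.exp (-(b : ℤ)) : WithZero (Multiplicative ℤ)) → red τ x = 0) :
    (𝒰.level b c).toSubmonoid ≤ integralMonoid F v :=
  (𝒰.level_le_multiIwahoriMonoid hv red hbc hred).trans (multiIwahoriMonoid_le_integralMonoid v red)

variable (hv : ∀ τ, (p : 𝓞 F) ∈ (v τ).asIdeal) (red : ∀ τ : F →+* E, (v τ).adicCompletionIntegers F →+* S)
  (hbc : b ≤ c)
  (hred : ∀ τ (x : (v τ).adicCompletionIntegers F),
    Valued.v (x : (v τ).adicCompletion F) ≤ (WithZero.exp (-(b : ℤ)) : WithZero (Multiplicative ℤ)) → red τ x = 0)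

include hv hbc hred

/-- **The weight bridge `Φ : H^i(U(b,c), ⨂_τ Sym^{k−2}(S²)) → H^i(X_{U(b,c)}, S)`**: the lattice/tensor
identification, the push-forward along `∏_τ λ₁` and the comparison of `S(∏χ)`-coefficients with trivial
coefficients. [cite: KhareThorne2017, §6.4, Prop. 6.13] [cite: Hida1994AIF, §2, Prop. 2.1] -/
def weightBridge (i : ℕ) :
    LevelAction.cohomology (globalEmbedding 2 F) (integralMonoid F v) (symLatticeAction S E F k v red) (𝒰.level b c) i →ₗ[S]
      ArithmeticQuotient.cohomology S (globalEmbedding 2 F) (𝒰.level b c) S i :=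
  (cohomologyIso (globalEmbedding 2 F) (multiIwahoriMonoid F v red) (lowCharJ F v red fun _ => k - 2) (𝒰.level b c)
      (𝒰.level_le_multiIwahoriMonoid hv red hbc hred)
      (𝒰.lowCharJ_eq_one_of_mem_level hv red hbc hred fun _ => k - 2) i).hom.hom ∘ₗ
    (pushforwardCohomology (globalEmbedding 2 F) (multiIwahoriMonoid F v red) (symPowCoeffJ F v red fun _ => k - 2)
      (lowCharJ F v red fun _ => k - 2) (𝒰.level b c) (coeffX₁J S fun _ => k - 2)
      (coeffX₁J_comp_symPowCoeffJ fun _ => k - 2) i).hom ∘ₗ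
    (cohomologyIsoLatticeTensor S E F k v red (globalEmbedding 2 F)
      (𝒰.level_le_multiIwahoriMonoid hv red hbc hred) i).inv.hom

/-- **Twisted Hecke equivariance of the weight bridge**: `Φ ∘ [U g U] = (∏χ)(g) · T_g ∘ Φ` for `g` in the
multi-place Iwahori monoid. [cite: KhareThorne2017, §6.4, proof of Prop. 6.13] -/
theorem weightBridge_comp_heckeCohomology {g : FiniteAdelicGL 2 F} (hg : g ∈ multiIwahoriMonoid F v red) (i : ℕ) :
    𝒰.weightBridge k hv red hbc hred i ∘ₗ
        heckeCohomology (globalEmbedding 2 F) (integralMonoid F v) (symLatticeAction S E F k v red) (𝒰.level b c)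
          (𝒰.level_le_integralMonoid' hv red hbc hred) (multiIwahoriMonoid_le_integralMonoid v red hg) i =
      lowCharFunJ F v red (fun _ => k - 2) ⟨g, hg⟩ •
        (ArithmeticQuotient.heckeEnd S (𝒰.level b c) g S (globalEmbedding 2 F) i ∘ₗ 𝒰.weightBridge k hv red hbc hred i) := by
  have hU := 𝒰.level_le_multiIwahoriMonoid hv red hbc hred
  have hχ := 𝒰.lowCharJ_eq_one_of_mem_level hv red hbc hred (fun _ => k - 2)
  -- (a) the lattice/tensor identification
  have ha := inv_hom_comp_eq_of_hom_comp_eq _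
    (cohomologyIsoLatticeTensor_hom_comp_heckeCohomology S E F k v red (globalEmbedding 2 F) hU i hg)
  -- (b) the push-forward
  have hb := heckeCohomology_comp_pushforwardCohomology (globalEmbedding 2 F) (multiIwahoriMonoid F v red)
    (symPowCoeffJ F v red fun _ => k - 2) (lowCharJ F v red fun _ => k - 2) (𝒰.level b c)
    (coeffX₁J S fun _ => k - 2) (coeffX₁J_comp_symPowCoeffJ fun _ => k - 2) hU hg i
  -- (c) trivial-on-the-level comparison, twisted by `∏χ(g)`
  have hc := heckeCohomology_comp_cohomologyIso_hom (globalEmbedding 2 F) hU hχ hg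
    (E := lowCharJ F v red (fun _ => k - 2) ⟨g, hg⟩)
    (fun y hy hyd => lowCharJ_eq_of_mem_doubleCosetQuot red (fun _ => k - 2) hU hχ hg hy hyd) i
  -- (d) the coefficient change along `∏χ(g)` is the scalar
  have hd : (ArithmeticQuotient.cohomologyCoeffMap (globalEmbedding 2 F) (𝒰.level b c)
      (lowCharJ F v red (fun _ => k - 2) ⟨g, hg⟩) i).hom =
      lowCharFunJ F v red (fun _ => k - 2) ⟨g, hg⟩ • LinearMap.id :=
    LinearMap.ext fun x => ArithmeticQuotient.cohomologyCoeffMap_hom_apply_of_forall_eq_smul (globalEmbedding 2 F)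
      (𝒰.level b c) _ _ (fun s => by rw [lowCharJ_apply, smul_eq_mul]) i x
  refine LinearMap.ext fun x => ?_
  have e1 := LinearMap.congr_fun ha x
  have e2 := LinearMap.congr_fun hb
    ((cohomologyIsoLatticeTensor S E F k v red (globalEmbedding 2 F) hU i).inv.hom x)
  have e3 := LinearMap.congr_fun hc
    ((pushforwardCohomology (globalEmbedding 2 F) (multiIwahoriMonoid F v red) (symPowCoeffJ F v red fun _ => k - 2)
      (lowCharJ F v red fun _ => k - 2) (𝒰.level b c) (coeffX₁J S fun _ => k - 2)
      (coeffX₁J_comp_symPowCoeffJ fun _ => k - 2) i).hom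
      ((cohomologyIsoLatticeTensor S E F k v red (globalEmbedding 2 F) hU i).inv.hom x))
  simp only [LinearMap.coe_comp, Function.comp_apply, hd, LinearMap.smul_apply, LinearMap.id_apply] at e1 e2 e3
  simp only [weightBridge, LinearMap.coe_comp, Function.comp_apply, LinearMap.smul_apply]
  rw [e1, e2, e3]

/-- **On the nose equivariance** for elements with trivial components at the index places (the good
`t_{w,j}`): `Φ ∘ [U g U] = T_g ∘ Φ`. [cite: KhareThorne2017, §6.4] -/
theorem weightBridge_comp_heckeCohomology_of_forall {g : FiniteAdelicGL 2 F} (hg : g ∈ multiIwahoriMonoid F v red)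
    (h1 : ∀ τ, localComponent 2 F (v τ) g = 1) (i : ℕ) :
    𝒰.weightBridge k hv red hbc hred i ∘ₗ
        heckeCohomology (globalEmbedding 2 F) (integralMonoid F v) (symLatticeAction S E F k v red) (𝒰.level b c)
          (𝒰.level_le_integralMonoid' hv red hbc hred) (multiIwahoriMonoid_le_integralMonoid v red hg) i =
      ArithmeticQuotient.heckeEnd S (𝒰.level b c) g S (globalEmbedding 2 F) i ∘ₗ 𝒰.weightBridge k hv red hbc hred i := by
  rw [𝒰.weightBridge_comp_heckeCohomology k hv red hbc hred hg i, lowCharFunJ_eq_one_of_forall red _ _ h1, one_smul]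

/-- **`Φ ∘ U_{w,1} = U_{w,1} ∘ Φ`** (any place `w`). [cite: KhareThorne2017, §6.4] -/
theorem weightBridge_comp_heckeCohomology_heckeElement (w : HeightOneSpectrum (𝓞 F))
    (hw : heckeElement 2 F w 1 ∈ multiIwahoriMonoid F v red) (i : ℕ) :
    𝒰.weightBridge k hv red hbc hred i ∘ₗ
        heckeCohomology (globalEmbedding 2 F) (integralMonoid F v) (symLatticeAction S E F k v red) (𝒰.level b c)
          (𝒰.level_le_integralMonoid' hv red hbc hred) (multiIwahoriMonoid_le_integralMonoid v red hw) i =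
      ArithmeticQuotient.heckeEnd S (𝒰.level b c) (heckeElement 2 F w 1) S (globalEmbedding 2 F) i ∘ₗ
        𝒰.weightBridge k hv red hbc hred i := by
  rw [𝒰.weightBridge_comp_heckeCohomology k hv red hbc hred hw i, lowCharFunJ_heckeElement red _ w hw, one_smul]

/-- **`Φ ∘ ⟨u⟩ = (∏_τ red_τ(u_{v(τ),1})^{k−2}) · ⟨u⟩ ∘ Φ`** for the diamonds `diamondPi u`.
[cite: KhareThorne2017, §6.4] -/
theorem weightBridge_comp_heckeCohomology_diamondPi (u : ∀ w : PlacesAbove F p, (Fin 2 → (w.1.adicCompletionIntegers F)ˣ))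
    (hu : diamondPi 2 F p u ∈ multiIwahoriMonoid F v red) (i : ℕ) :
    𝒰.weightBridge k hv red hbc hred i ∘ₗ
        heckeCohomology (globalEmbedding 2 F) (integralMonoid F v) (symLatticeAction S E F k v red) (𝒰.level b c)
          (𝒰.level_le_integralMonoid' hv red hbc hred) (multiIwahoriMonoid_le_integralMonoid v red hu) i =
      (∏ τ, red τ ((u ⟨v τ, hv τ⟩ 1 : ((v τ).adicCompletionIntegers F)ˣ) : (v τ).adicCompletionIntegers F) ^ (k - 2)) •
        (ArithmeticQuotient.heckeEnd S (𝒰.level b c) (diamondPi 2 F p u) S (globalEmbedding 2 F) i ∘ₗ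
          𝒰.weightBridge k hv red hbc hred i) := by
  rw [𝒰.weightBridge_comp_heckeCohomology k hv red hbc hred hu i, lowCharFunJ_diamondPi red _ hv u hu]

/-! ### The ordinary parts -/

omit hv hbc hred in
/-- `⨅_{w ∈ placesAbove} = ⨅_{w : PlacesAbove}` for families of submodules. [folklore] -/
theorem iInf_placesAbove_eq {R M : Type*} [Semiring R] [AddCommMonoid M] [Module R M]
    (f : HeightOneSpectrum (𝓞 F) → Submodule R M) :
    (⨅ w ∈ placesAbove F p, f w) = ⨅ w : PlacesAbove F p, f w.1 :=
  le_antisymm (le_iInf fun w => iInf₂_le w.1 (mem_placesAbove.2 w.2))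
    (le_iInf₂ fun w hw => iInf_le (fun w : PlacesAbove F p => f w.1) ⟨w, mem_placesAbove.1 hw⟩)

omit hv hbc hred in
open scoped Classical in
/-- **`[U (∏_{w ∈ s} t_w^r) U] = ∏_{w ∈ s} [U t_w U]^r` on `H^i(U(b,c), τ)`** for `s` a set of places above
`p`, `r ≤ c` (any coefficient system on a monoid containing the `t_{w,1}`). [cite: KhareThorne2017, §6.2, §6.4] -/
theorem heckeCohomology_level_upElement_eq_noncommProd {R' : Type} [CommRing R'] {V : Type} [AddCommGroup V]
    [Module R' V] {Δ : Submonoid (FiniteAdelicGL 2 F)} (τ : Δ →* Module.End R' V) {b' c' : ℕ}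
    (hU : (𝒰.level b' c').toSubmonoid ≤ Δ) (hΔ : ∀ w : HeightOneSpectrum (𝓞 F), heckeElement 2 F w 1 ∈ Δ)
    (h𝒰 : 𝒰.IsMaximalAbove) {r : ℕ} (hr : r ≤ c') (i : ℕ) (s : Finset (HeightOneSpectrum (𝓞 F)))
    (hs : ∀ w ∈ s, (p : 𝓞 F) ∈ w.asIdeal)
    (hcomm : (s : Set (HeightOneSpectrum (𝓞 F))).Pairwise fun w w' =>
      Commute (heckeCohomology (globalEmbedding 2 F) Δ τ (𝒰.level b' c') hU (hΔ w) i ^ r)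
        (heckeCohomology (globalEmbedding 2 F) Δ τ (𝒰.level b' c') hU (hΔ w') i ^ r)) :
    heckeCohomology (globalEmbedding 2 F) Δ τ (𝒰.level b' c') hU (upElement_mem_of_forall Δ hΔ s r) i =
      s.noncommProd (fun w => heckeCohomology (globalEmbedding 2 F) Δ τ (𝒰.level b' c') hU (hΔ w) i ^ r) hcomm := by
  induction s using Finset.induction_on with
  | empty =>
    rw [Finset.noncommProd_empty]
    have h1 : TameLevel.upElement (K := F) ∅ r = 1 := by rw [TameLevel.upElement, Finset.noncommProd_empty]
    rw [heckeCohomology_congr (globalEmbedding 2 F) Δ τ (𝒰.level b' c') hU (upElement_mem_of_forall Δ hΔ ∅ r)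
      Δ.one_mem h1 i]
    exact heckeCohomology_of_mem_level (globalEmbedding 2 F) Δ τ (𝒰.level b' c') hU (one_mem _) i
  | insert w s hws ih =>
    rw [Finset.noncommProd_insert_of_notMem _ _ _ _ hws,
      heckeCohomology_level_upElement_insert (globalEmbedding 2 F) Δ τ h𝒰 hr hws (hs w (Finset.mem_insert_self w s)) hU hΔ i,
      ih (fun w' hw' => hs w' (Finset.mem_insert_of_mem hw')) (hcomm.mono fun _ h => Finset.mem_insert_of_mem h)]
    exact (Finset.noncommProd_commute s _ _ _ fun w' hw' => hcomm (Finset.mem_insert_self w s)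
      (Finset.mem_insert_of_mem hw') (fun h => hws (h ▸ hw'))).eq.symm

omit hv hbc hred in
/-- **The `U_p^{(r)}`-ordinary part is the intersection of the `U_{v,1}`-ordinary parts over the places
above `p`** on `H^i(U(b,c), τ)` (finite module, `1 ≤ r ≤ c`). [cite: KhareThorne2017, §2.4, Lemma 2.10; §6.4] -/
theorem iInf_range_pow_upElement_eq {R' : Type} [CommRing R'] {V : Type} [AddCommGroup V]
    [Module R' V] {Δ : Submonoid (FiniteAdelicGL 2 F)} (τ : Δ →* Module.End R' V) {b' c' : ℕ}
    (hU : (𝒰.level b' c').toSubmonoid ≤ Δ) (hΔ : ∀ w : HeightOneSpectrum (𝓞 F), heckeElement 2 F w 1 ∈ Δ)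
    (h𝒰 : 𝒰.IsMaximalAbove) {r : ℕ} (hr1 : 1 ≤ r) (hr : r ≤ c') (i : ℕ)
    (hcomm : ∀ w w' : PlacesAbove F p, Commute (heckeCohomology (globalEmbedding 2 F) Δ τ (𝒰.level b' c') hU (hΔ w.1) i)
      (heckeCohomology (globalEmbedding 2 F) Δ τ (𝒰.level b' c') hU (hΔ w'.1) i))
    [Finite (LevelAction.cohomology (globalEmbedding 2 F) Δ τ (𝒰.level b' c') i)] :
    (⨅ n : ℕ, LinearMap.range (heckeCohomology (globalEmbedding 2 F) Δ τ (𝒰.level b' c') hU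
        (upElement_mem_of_forall Δ hΔ (placesAbove F p) r) i ^ n)) =
      ⨅ (w : PlacesAbove F p) (n : ℕ), LinearMap.range (heckeCohomology (globalEmbedding 2 F) Δ τ (𝒰.level b' c') hU (hΔ w.1) i ^ n) := by
  have hcomm' : ((placesAbove F p : Finset _) : Set (HeightOneSpectrum (𝓞 F))).Pairwise fun w w' =>
      Commute (heckeCohomology (globalEmbedding 2 F) Δ τ (𝒰.level b' c') hU (hΔ w) i ^ r)
        (heckeCohomology (globalEmbedding 2 F) Δ τ (𝒰.level b' c') hU (hΔ w') i ^ r) := fun w hw w' hw' _ =>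
    (hcomm ⟨w, mem_placesAbove.1 hw⟩ ⟨w', mem_placesAbove.1 hw'⟩).pow_pow r r
  rw [𝒰.heckeCohomology_level_upElement_eq_noncommProd τ hU hΔ h𝒰 hr i (placesAbove F p)
      (fun w hw => mem_placesAbove.1 hw) hcomm', iInf_range_pow_noncommProd_eq, iInf_placesAbove_eq]
  exact iInf_congr fun w => iInf_range_pow_pow_eq _ hr1

/-- **The weight bridge is a bijection of the `U_p`-ordinary parts** (independence of weight at finite
level, torsion coefficients): for `1 ≤ r ≤ c`, `red_τ(ϖ_{v(τ)})^r = 0`, finite cohomology groups and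
commuting `U_{v,1}` on the lattice side, `Φ` maps `⋂_{v ∣ p} ⋂ₙ range U_{v,1}ⁿ ⊆ H^i(U(b,c), ⨂_τ Sym^{k−2}(S²))`
bijectively onto `⋂_{v ∣ p} ⋂ₙ range U_{v,1}ⁿ ⊆ H^i(X_{U(b,c)}, S)`.
[cite: KhareThorne2017, §6.4, Prop. 6.13] [cite: Hida1994AIF, §2, Prop. 2.1; §3] -/
theorem bijOn_weightBridge (h𝒰 : 𝒰.IsMaximalAbove) {r : ℕ} (hr1 : 1 ≤ r) (hrc : r ≤ c)
    (hr : ∀ τ, red τ ⟨_, uniformizerAt_mem_adicCompletionIntegers F (v τ)⟩ ^ r = 0) (i : ℕ)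
    (hcomm : ∀ w w' : PlacesAbove F p,
      Commute (heckeCohomology (globalEmbedding 2 F) (integralMonoid F v) (symLatticeAction S E F k v red) (𝒰.level b c)
          (𝒰.level_le_integralMonoid' hv red hbc hred)
          (multiIwahoriMonoid_le_integralMonoid v red (heckeElementOne_mem_multiIwahoriMonoid red w.1)) i)
        (heckeCohomology (globalEmbedding 2 F) (integralMonoid F v) (symLatticeAction S E F k v red) (𝒰.level b c)
          (𝒰.level_le_integralMonoid' hv red hbc hred)
          (multiIwahoriMonoid_le_integralMonoid v red (heckeElementOne_mem_multiIwahoriMonoid red w'.1)) i))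
    [Finite (LevelAction.cohomology (globalEmbedding 2 F) (integralMonoid F v) (symLatticeAction S E F k v red) (𝒰.level b c) i)]
    [Finite (ArithmeticQuotient.cohomology S (globalEmbedding 2 F) (𝒰.level b c) S i)] :
    Set.BijOn (𝒰.weightBridge k hv red hbc hred i)
      (⨅ (w : PlacesAbove F p) (n : ℕ), LinearMap.range
        (heckeCohomology (globalEmbedding 2 F) (integralMonoid F v) (symLatticeAction S E F k v red) (𝒰.level b c)
          (𝒰.level_le_integralMonoid' hv red hbc hred)
          (multiIwahoriMonoid_le_integralMonoid v red (heckeElementOne_mem_multiIwahoriMonoid red w.1)) i ^ n) :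
        Submodule S _)
      (⨅ (w : PlacesAbove F p) (n : ℕ), LinearMap.range
        (ArithmeticQuotient.heckeEnd S (𝒰.level b c) (heckeElement 2 F w.1 1) S (globalEmbedding 2 F) i ^ n) :
        Submodule S _) := by
  have hU := 𝒰.level_le_multiIwahoriMonoid hv red hbc hred
  have hs : ∀ τ : F →+* E, v τ ∈ placesAbove F p := fun τ => mem_placesAbove.2 (hv τ)
  haveI : Finite (LevelAction.cohomology (globalEmbedding 2 F) (multiIwahoriMonoid F v red)
      (symPowCoeffJ F v red fun _ => k - 2) (𝒰.level b c) i) :=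
    Finite.of_equiv _ (cohomologyIsoLatticeTensor S E F k v red (globalEmbedding 2 F) hU i).toLinearEquiv.symm.toEquiv
  -- independence of weight (tensor model), target converted to the places above `p`
  have h5 := 𝒰.independenceOfWeight_bijOn_level_ordinaryPart_tensor hv red hbc hred (fun _ => k - 2) hs r i
    h𝒰 hr1 hrc (fun w hw => mem_placesAbove.1 hw) hr
  rw [iInf_placesAbove_eq] at h5
  -- the lattice/tensor identification on the `U_p^{(r)}`-ordinary parts
  have hup : TameLevel.upElement (placesAbove F p) r ∈ multiIwahoriMonoid F v red :=
    upElement_mem_multiIwahoriMonoid F v red hs r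
  have hinv := inv_hom_comp_eq_of_hom_comp_eq _
    (cohomologyIsoLatticeTensor_hom_comp_heckeCohomology S E F k v red (globalEmbedding 2 F) hU i hup)
  have hLT := bijOn_iInf_range_pow_of_linearEquiv
    (cohomologyIsoLatticeTensor S E F k v red (globalEmbedding 2 F) hU i).toLinearEquiv.symm
    (U := heckeCohomology (globalEmbedding 2 F) (integralMonoid F v) (symLatticeAction S E F k v red) (𝒰.level b c)
      (hU.trans (multiIwahoriMonoid_le_integralMonoid v red)) (multiIwahoriMonoid_le_integralMonoid v red hup) i)
    (U' := heckeCohomology (globalEmbedding 2 F) (multiIwahoriMonoid F v red) (symPowCoeffJ F v red fun _ => k - 2)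
      (𝒰.level b c) hU hup i)
    (LinearMap.ext fun x => LinearMap.congr_fun hinv x)
  have hΦ : Set.BijOn (𝒰.weightBridge k hv red hbc hred i)
      (⨅ n : ℕ, LinearMap.range (heckeCohomology (globalEmbedding 2 F) (integralMonoid F v)
        (symLatticeAction S E F k v red) (𝒰.level b c) (hU.trans (multiIwahoriMonoid_le_integralMonoid v red))
        (multiIwahoriMonoid_le_integralMonoid v red hup) i ^ n) : Submodule S _)
      (⨅ (w : PlacesAbove F p) (n : ℕ), LinearMap.range
        (ArithmeticQuotient.heckeEnd S (𝒰.level b c) (heckeElement 2 F w.1 1) S (globalEmbedding 2 F) i ^ n) :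
        Submodule S _) :=
    h5.comp hLT
  -- the source converted to the places above `p`
  have hΔ : ∀ w : HeightOneSpectrum (𝓞 F), heckeElement 2 F w 1 ∈ integralMonoid F v := fun w =>
    multiIwahoriMonoid_le_integralMonoid v red (heckeElementOne_mem_multiIwahoriMonoid red w)
  have hsrc := 𝒰.iInf_range_pow_upElement_eq (symLatticeAction S E F k v red)
    (hU.trans (multiIwahoriMonoid_le_integralMonoid v red)) hΔ h𝒰 hr1 hrc i hcomm
  rw [hsrc] at hΦ
  exact hΦ

end TameLevel

end BigHeckeGLn

end Literature.NumberTheory.Automorphic
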